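import Mathlib
import HarnessLib
import Summits.HubbardSuperconductivity.HubbardSuperconductivity.Theorems.KLProgrammeKLRegimeCountertermOneVolumeMsE
import Summits.HubbardSuperconductivity.HubbardSuperconductivity.Theorems.KLProgrammeKLRegimeSplitBundleV12

/-!
# Route `KLProgramme` — crux K3, GEN 4 (bundle `klPredsV12`, Δ21): the COUNTERTERM child's BODY `CountertermP2 klPredsV12 klWindowC` — PROVED
# before the resplit, as the `EngineBoundsAtV8S` instance of the engine-slot-generic counterterm chain (seat hubbard-kl-k3c5-p1 g3)

`klPredsV12` (p1 g7, `…SplitBundleV12`) is `klPredsV11` with the single token `EngineBoundsAtV7S ↦ EngineBoundsAtV8S` (history `histV12`, two-leg slot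
`TwoLegStepV12` in V11's conjunct order), i.e. `klPredsV12 = klPredsE EngineBoundsAtV8S`, `histV12 = histE EngineBoundsAtV8S`,
`TwoLegStepV12 = TwoLegStepE EngineBoundsAtV8S`, all by `rfl` (§1).  Hence (§2) the counterterm child's body at gen 4 is the instance
**`CtE.countertermP2_klPredsV12 : CountertermP2 klPredsV12 klWindowC := CtE.countertermP2_klPredsE EngineBoundsAtV8S`** of the `E`-generic chain
(`…SplitTwoLegStepE`, `…CountertermBlockE`, `…CountertermContinuationE`, `…CountertermOneVolumeMsE`; mathematics of the one-volume construction: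
k3c3-p2, reading k3c3-p1 / k3c3-p3 / p1b, thresholds p2).  The gen-4 route closer is then the one-liner
`theorem KLRegimeCountertermV12_of : …Theses.KLProgramme.KLRegimeCountertermV12 := KLRegimeSplit.CtE.countertermP2_klPredsV12` filed `--workitem` on the id.
Also the block identities `CtHypMsE EngineBoundsAtV8S` / `CtOneVolumeMsE EngineBoundsAtV8S` need no V12 twins.  Proofs (`rfl` + one instance) only.
-/

noncomputable section

namespace Summit.HubbardSuperconductivity.HubbardSuperconductivity.Theorems.KLRegimeSplit

set_option linter.dupNamespace false -- summit = problem name (single-conjunct summit), D-0017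

open Real Finset Literature.MathematicalPhysics.QuantumLattice Literature.Probability.LatticeModels
open Summit.HubbardSuperconductivity.HubbardSuperconductivity.Theorems.KLProgrammeLegKernels

/-! ## §1 V12 IS the `EngineBoundsAtV8S` instance (`rfl`-level) -/

/-- `histV12 = histE EngineBoundsAtV8S`. -/
theorem histV12_eq_histE (L M : ℕ) [NeZero L] [NeZero M] (G : GeoConsts) (P : SplitConsts) (Q : EngConsts) (R : RenConsts) (β U μ : ℝ) :
    histV12 L M G P Q R β U μ = histE L M EngineBoundsAtV8S G P Q R β U μ := rfl

/-- `TwoLegStepV12 = TwoLegStepE EngineBoundsAtV8S`. -/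
theorem twoLegStepV12_eq_twoLegStepE (L M : ℕ) [NeZero L] [NeZero M] (G : GeoConsts) (P : SplitConsts) (Q : EngConsts) (R : RenConsts)
    (β U μ : ℝ) (K : TrigPolyC4v) (n : ℕ) :
    TwoLegStepV12 L M G P Q R β U μ K n = TwoLegStepE L M EngineBoundsAtV8S G P Q R β U μ K n := rfl

/-- **`klPredsV12 = klPredsE EngineBoundsAtV8S`.** -/
theorem klPredsV12_eq_klPredsE : klPredsV12 = klPredsE EngineBoundsAtV8S := rfl

/-! ## §2 The counterterm child's body at gen 4 -/

/-- **THE COUNTERTERM CHILD OF GEN 4 (body): `CountertermP2 klPredsV12 klWindowC`** — the `EngineBoundsAtV8S` instance of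
`CtE.countertermP2_klPredsE` (type-checks by `klPredsV12 = klPredsE EngineBoundsAtV8S`, `rfl`). -/
theorem CtE.countertermP2_klPredsV12 : CountertermP2 klPredsV12 klWindowC :=
  CtE.countertermP2_klPredsE EngineBoundsAtV8S

end Summit.HubbardSuperconductivity.HubbardSuperconductivity.Theorems.KLRegimeSplit

end
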